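import Literature.Analysis.FluidPDE.TemperedLinearisedNS
import HarnessLib

/-!
# The parasitic modes are tempered linearised solutions about `u = 0`

Companion to `Literature.Analysis.FluidPDE.IsTemperedLinearisedNSSolution`
(`Literature/Analysis/FluidPDE/TemperedLinearisedNS.lean`).

About the trivial background `u = 0` the linearised Navier–Stokes system is the Stokes system
`∂ₜv = Δv − ∇q`, `div v = 0`, which has the spatially constant "parasitic" solutions
`v(t, x) = b(t)`, `q(t, x) = −b'(t)·x` (Koch–Nadirashvili–Seregin–Šverák 2009, §1: "Equation (1.1)
has trivial non-constant solutions of the form `u(x,t) = b(t)`, `p(x,t) = −b'(t)x` … 'parasitic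
solutions'"). With the scale-natural choice `b(t) = (−t)^{-1/2} e` the pair
`v(t, x) = (−t)^{-1/2} e`, `q(t, x) = −⟪e, x⟫ / (2 (−t)^{3/2})`
obeys exactly the tempered growth bounds of the definition (constant `K = ‖e‖`), so it is a
**non-zero** element of the tempered solution class about `u = 0`
(`IsTemperedLinearisedNSSolution.parasitic_zero`). This is the witness behind the "modulo slice-wise
constants" form of the linear Liouville statements of route SymmetryModuliCount
(NavierStokesRegularity): growth alone does not exclude the modes `b(t)`.

Everything here is proved; no hypotheses, no new facts.

## References

* G. Koch, N. Nadirashvili, G. Seregin, V. Šverák, *Liouville theorems for the Navier–Stokes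
  equations and applications*, Acta Math. 203 (2009), §1 (parasitic solutions). arXiv:0709.3599.
-/

noncomputable section

open Set Function InnerProductSpace
open scoped ContDiff Laplacian RealInnerProductSpace

namespace Literature.Analysis.FluidPDE

variable {E : Type*} [NormedAddCommGroup E] [InnerProductSpace ℝ E] [FiniteDimensional ℝ E]

/-- **Parasitic modes are tempered.** About the zero background `u = 0`, for every fixed vector
`e`, the pair `v(t, x) = (−t)^{-1/2} e`, `q(t, x) = −⟪e, x⟫ / (2 (−t)^{3/2})` is a tempered
classical solution of the linearised (= Stokes) system on `(-∞, 0) × E`: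
`∂ₜv = (2(−t)^{3/2})⁻¹ e = −∇q`, `Δv = 0`, `div v = 0`, growth constant `K = ‖e‖`.
The case `b(t) = (−t)^{-1/2} e` of the parasitic solutions `u = b(t)`, `p = −b'(t)·x`.
[cite: KNSS2009, §1 (parasitic solutions)] -/
theorem IsTemperedLinearisedNSSolution.parasitic_zero (e : E) :
    IsTemperedLinearisedNSSolution (0 : ℝ → E → E) (fun t _ => (Real.sqrt (-t))⁻¹ • e)
      (fun t x => -⟪e, x⟫ / (2 * Real.sqrt (-t) ^ 3)) := by
  have hsq : ∀ t : ℝ, t < 0 → 0 < Real.sqrt (-t) := fun t ht => Real.sqrt_pos.2 (by linarith)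
  -- the pressure slice is the linear functional `⟪-(2 √(-t)³)⁻¹ • e, ·⟫`
  have hfun : ∀ t : ℝ, (fun x : E => -⟪e, x⟫ / (2 * Real.sqrt (-t) ^ 3)) =
      ⇑(toDual ℝ E (-(2 * Real.sqrt (-t) ^ 3)⁻¹ • e)) := by
    intro t
    ext y
    rw [toDual_apply_apply, real_inner_smul_left]
    ring
  refine ⟨?_, ?_, ?_, ?_, ?_⟩
  · -- joint smoothness of `v` on `(-∞, 0) × E`
    intro p hp
    have ht : p.1 < 0 := (mem_prod.1 hp).1
    have hs : ContDiffAt ℝ ∞ (fun p : ℝ × E => Real.sqrt (-p.1)) p :=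
      contDiffAt_fst.neg.sqrt (by show -p.1 ≠ 0; exact (neg_pos.2 ht).ne')
    have h1 : ContDiffAt ℝ ∞ (fun p : ℝ × E => (Real.sqrt (-p.1))⁻¹ • e) p :=
      (hs.inv (hsq _ ht).ne').smul contDiffAt_const
    exact h1.contDiffWithinAt
  · -- joint smoothness of `q` on `(-∞, 0) × E`
    intro p hp
    have ht : p.1 < 0 := (mem_prod.1 hp).1
    have hs : ContDiffAt ℝ ∞ (fun p : ℝ × E => Real.sqrt (-p.1)) p :=
      contDiffAt_fst.neg.sqrt (by show -p.1 ≠ 0; exact (neg_pos.2 ht).ne')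
    have h3 : ContDiffAt ℝ ∞ (fun p : ℝ × E => 2 * Real.sqrt (-p.1) ^ 3) p :=
      contDiffAt_const.mul (hs.pow 3)
    have h0 : (2 * Real.sqrt (-p.1) ^ 3) ≠ 0 := by have := hsq _ ht; positivity
    have h1 : ContDiffAt ℝ ∞ (fun p : ℝ × E => -⟪e, p.2⟫ / (2 * Real.sqrt (-p.1) ^ 3)) p :=
      (contDiffAt_const.inner ℝ contDiffAt_snd).neg.div h3 h0
    exact h1.contDiffWithinAt
  · -- tempered growth with `K = ‖e‖`
    refine ⟨‖e‖, fun t ht x => ⟨?_, ?_⟩⟩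
    · have hs := hsq t ht
      have hnt : 0 < -t := by linarith
      have h1 : ‖(Real.sqrt (-t))⁻¹ • e‖ = ‖e‖ / Real.sqrt (-t) := by
        rw [norm_smul, norm_inv, Real.norm_of_nonneg hs.le, div_eq_inv_mul]
      have h2 : 0 ≤ ‖e‖ * (1 + ‖x‖) / (-t) := by positivity
      simp only [h1]
      linarith
    · have hs := hsq t ht
      have hnt : 0 < -t := by linarith
      have h1 : |-⟪e, x⟫ / (2 * Real.sqrt (-t) ^ 3)| ≤ ‖e‖ * ‖x‖ / (2 * Real.sqrt (-t) ^ 3) := by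
        rw [abs_div, abs_neg, abs_of_pos (by positivity : (0 : ℝ) < 2 * Real.sqrt (-t) ^ 3)]
        exact div_le_div_of_nonneg_right (abs_real_inner_le_norm e x) (by positivity)
      have h2 : ‖e‖ * ‖x‖ / (2 * Real.sqrt (-t) ^ 3) ≤ ‖e‖ * (1 + ‖x‖) / Real.sqrt (-t) ^ 3 := by
        rw [div_le_div_iff₀ (by positivity) (by positivity)]
        have : 0 ≤ ‖e‖ * Real.sqrt (-t) ^ 3 := by positivity
        have : 0 ≤ ‖e‖ * ‖x‖ * Real.sqrt (-t) ^ 3 := by positivity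
        nlinarith
      have h3 : 0 ≤ ‖e‖ / (-t) := by positivity
      linarith
  · -- `div v = 0`: the slices of `v` are constant
    intro t _ x
    simp [VectorCalculus.divergence]
  · -- the linearised momentum equation about `u = 0`: `∂ₜv = Δv − ∇q`
    intro t ht x
    have hs := hsq t ht
    have hd : HasDerivAt (fun s : ℝ => (Real.sqrt (-s))⁻¹ • e)
        ((-(-1 / (2 * Real.sqrt (-t))) / Real.sqrt (-t) ^ 2) • e) t := by
      have h1 : HasDerivAt (fun s : ℝ => Real.sqrt (-s)) (-1 / (2 * Real.sqrt (-t))) t := by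
        simpa using ((hasDerivAt_id t).neg.sqrt (by show -t ≠ 0; exact (neg_pos.2 ht).ne'))
      exact (h1.inv hs.ne').smul_const e
    have e1 : timeDeriv (fun t (_ : E) => (Real.sqrt (-t))⁻¹ • e) t x =
        ((-(-1 / (2 * Real.sqrt (-t))) / Real.sqrt (-t) ^ 2) • e) := by
      simp only [timeDeriv]
      exact hd.deriv
    have e2 : gradient (fun x : E => -⟪e, x⟫ / (2 * Real.sqrt (-t) ^ 3)) x =
        -(2 * Real.sqrt (-t) ^ 3)⁻¹ • e := by
      rw [gradient, hfun t, ContinuousLinearMap.fderiv, LinearIsometryEquiv.symm_apply_apply]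
    have e3 : Δ (fun (_ : E) => (Real.sqrt (-t))⁻¹ • e) x = 0 := by
      rw [InnerProductSpace.laplacian_const]; rfl
    rw [e1, e2]
    simp only [Pi.zero_apply, convect, map_zero, fderiv_zero, zero_apply, add_zero, e3, zero_sub,
      neg_smul, neg_neg]
    congr 1
    field_simp

omit [FiniteDimensional ℝ E] in
/-- The parasitic modes are **spatially constant on every slice** and, for `e ≠ 0`, not
identically zero on any slice `t < 0` — so the tempered class about `u = 0` is non-trivial, and a
Liouville statement for it can at best hold modulo slice-wise constants. [folklore] -/
theorem IsTemperedLinearisedNSSolution.parasitic_zero_ne_zero {e : E} (he : e ≠ 0) {t : ℝ}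
    (ht : t < 0) (x : E) : (fun t (_ : E) => (Real.sqrt (-t))⁻¹ • e) t x ≠ 0 := by
  have hs : 0 < Real.sqrt (-t) := Real.sqrt_pos.2 (by linarith)
  simp [hs.ne', he]

end Literature.Analysis.FluidPDE
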